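import Literature.MathematicalPhysics.QuantumManyBody.BoseEinsteinCondensation
import Mathlib.MeasureTheory.Group.LIntegral
import Mathlib.MeasureTheory.Measure.Haar.Unique
import Mathlib.MeasureTheory.Measure.Prod
import HarnessLib

/-!
# Route BECCutLineWeakDisorder — `WitnessTransfer`, occupation estimate at a coincidence point III:
# moments of the occupation functional of a Markov process with a radial kernel

Support file (does not close the item) for item stmt-AtomisticToContinuum-14978
(`Summit.AtomisticToContinuum.BoseEinsteinCondensation.Theses.BECCutLineWeakDisorder`, decl
`WitnessTransfer`), stub (S8) `stub_threeDim_occupation_pz` of line `Sketch`. The probabilistic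
core of the estimate, for an ABSTRACT process `Z : ℝ≥0 → Ω → ℝ³` whose marginals at times
`t > 0` have a radial density `ρ_t(|w|)` and which has the Markov factorisation
`E[F(Z_s) H(Z_{s+τ})] = E[F(Z_s) E'[H(Z_s + Z'_τ)]]`. For the occupation functional
`J = ∫_{(0,T]} g(|Z_s|) ds` of a radial `g ≥ 0`:

* `lintegral_occupation_eq_space` — `E J = ∫ g(|w|) (∫_{(0,T]} ρ_s(|w|) ds) dw` (Tonelli);
* `sq_setLIntegral_Ioc_le` — `(∫_{(a,b]} φ)² ≤ 2 ∫_{(a,b]} φ(s) ∫_{(s,b]} φ`;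
* `potential_ae_le` — `∫_{(s,T]} E'[g(|z + Z'_{t-s}|)] dt ≤ C K m` for a.e. `z`, from
  `∫_{(0,∞)} ρ_τ(|w|) dτ ≤ C/|w|` and the potential bound `∫ g(|w|)/|w − z| dw ≤ K m` for a.e. `z`;
* `lintegral_occupation_sq_le` — the second moment `E[J²] ≤ 2 C K m · E J` (Markov
  factorisation at each pair of times `s < t`, and the above along `Z_s`).

## References

* K. L. Chung, Z. Zhao, *From Brownian Motion to Schrödinger's Equation* (1995), §3.2.
  [ChungZhao1995]
* D. Revuz, M. Yor, *Continuous Martingales and Brownian Motion* (1999), Ch. III §1.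
  [RevuzYor1999]
-/

noncomputable section

open MeasureTheory ProbabilityTheory Filter Set Metric
open scoped ENNReal NNReal Topology

namespace Summit.AtomisticToContinuum.BoseEinsteinCondensation.Theorems.CutLineWitness

open Literature.MathematicalPhysics.QuantumManyBody.BoseGas

variable {Ω : Type*} [MeasurableSpace Ω] {P : Measure Ω} {Z : ℝ≥0 → Ω → Space}
  {ρ : ℝ → ℝ → ℝ≥0∞} {g : ℝ → ℝ≥0∞}

/-! ### Measurability -/

/-- The process read at real times is jointly measurable. [folklore] -/
theorem measurable_proc_real (hZ : Measurable fun p : Ω × ℝ≥0 => Z p.2 p.1) :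
    Measurable fun p : Ω × ℝ => Z p.2.toNNReal p.1 :=
  hZ.comp (measurable_fst.prodMk (measurable_real_toNNReal.comp measurable_snd))

/-- Each real-time marginal of the process is measurable. [folklore] -/
theorem measurable_proc_at (hZ : Measurable fun p : Ω × ℝ≥0 => Z p.2 p.1) (t : ℝ≥0) :
    Measurable (Z t) :=
  hZ.comp (measurable_id.prodMk measurable_const)

/-- The occupation integrand `(ω, s) ↦ g |Z_{s⁺}(ω)|` is jointly measurable. [folklore] -/
theorem measurable_occupationIntegrand (hZ : Measurable fun p : Ω × ℝ≥0 => Z p.2 p.1)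
    (hg : Measurable g) : Measurable fun p : Ω × ℝ => g ‖Z p.2.toNNReal p.1‖ :=
  hg.comp (measurable_proc_real hZ).norm

/-- The occupation functional `ω ↦ ∫_{(0,T]} g |Z_s(ω)| ds` is measurable (Tonelli). [folklore] -/
theorem measurable_occupation (hZ : Measurable fun p : Ω × ℝ≥0 => Z p.2 p.1) (hg : Measurable g)
    (T : ℝ) : Measurable fun ω => ∫⁻ s in Ioc 0 T, g ‖Z s.toNNReal ω‖ :=
  (measurable_occupationIntegrand hZ hg).lintegral_prod_right' (ν := volume.restrict (Ioc 0 T))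

/-- The tail occupation `(ω, s) ↦ ∫_{(s,T]} g |Z_t(ω)| dt` is jointly measurable. [folklore] -/
theorem measurable_tailOccupation (hZ : Measurable fun p : Ω × ℝ≥0 => Z p.2 p.1)
    (hg : Measurable g) (T : ℝ) :
    Measurable fun p : Ω × ℝ => ∫⁻ t in Ioc p.2 T, g ‖Z t.toNNReal p.1‖ := by
  set S : Set ((Ω × ℝ) × ℝ) := {q | q.1.2 < q.2} ∩ {q | q.2 ≤ T} with hS
  have hSm : MeasurableSet S :=
    (measurableSet_lt (measurable_snd.comp measurable_fst) measurable_snd).inter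
      (measurableSet_le measurable_snd measurable_const)
  have hG : Measurable fun q : (Ω × ℝ) × ℝ => g ‖Z q.2.toNNReal q.1.1‖ :=
    hg.comp ((measurable_proc_real hZ).comp
      ((measurable_fst.comp measurable_fst).prodMk measurable_snd)).norm
  have h2 := (hG.indicator hSm).lintegral_prod_right' (ν := (volume : Measure ℝ))
  have heq : (fun p : Ω × ℝ => ∫⁻ t in Ioc p.2 T, g ‖Z t.toNNReal p.1‖) =
      fun p => ∫⁻ t, S.indicator (fun q : (Ω × ℝ) × ℝ => g ‖Z q.2.toNNReal q.1.1‖) (p, t) := by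
    funext p
    rw [← lintegral_indicator measurableSet_Ioc]
    refine lintegral_congr fun t => ?_
    by_cases ht : t ∈ Ioc p.2 T
    · rw [Set.indicator_of_mem ht, Set.indicator_of_mem (show (p, t) ∈ S from ⟨ht.1, ht.2⟩)]
    · rw [Set.indicator_of_notMem ht,
        Set.indicator_of_notMem (show (p, t) ∉ S from fun h => ht ⟨h.1, h.2⟩)]
  rw [heq]
  exact h2

/-! ### First moment -/

/-- Tonelli: `E J = ∫_{(0,T]} E[g |Z_s|] ds`. [folklore] -/
theorem lintegral_occupation_eq [SFinite P] (hZ : Measurable fun p : Ω × ℝ≥0 => Z p.2 p.1)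
    (hg : Measurable g) (T : ℝ) :
    ∫⁻ ω, (∫⁻ s in Ioc 0 T, g ‖Z s.toNNReal ω‖) ∂P = ∫⁻ s in Ioc 0 T, ∫⁻ ω, g ‖Z s.toNNReal ω‖ ∂P :=
  lintegral_lintegral_swap (measurable_occupationIntegrand hZ hg).aemeasurable

/-- **First moment through the density**: `E J = ∫ g(|w|) (∫_{(0,T]} ρ_s(|w|) ds) dw`.
[folklore] -/
theorem lintegral_occupation_eq_space [SFinite P] (hZ : Measurable fun p : Ω × ℝ≥0 => Z p.2 p.1)
    (hg : Measurable g) (hρ : Measurable fun p : ℝ × ℝ => ρ p.1 p.2)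
    (hlaw : ∀ t : ℝ≥0, t ≠ 0 → ∀ F : Space → ℝ≥0∞, Measurable F →
      ∫⁻ ω, F (Z t ω) ∂P = ∫⁻ w, ρ t ‖w‖ * F w) (T : ℝ) :
    ∫⁻ ω, (∫⁻ s in Ioc 0 T, g ‖Z s.toNNReal ω‖) ∂P =
      ∫⁻ w : Space, g ‖w‖ * ∫⁻ s in Ioc 0 T, ρ s ‖w‖ := by
  rw [lintegral_occupation_eq hZ hg T]
  have h1 : ∀ s ∈ Ioc (0 : ℝ) T,
      ∫⁻ ω, g ‖Z s.toNNReal ω‖ ∂P = ∫⁻ w : Space, ρ s ‖w‖ * g ‖w‖ := by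
    intro s hs
    have h := hlaw s.toNNReal (Real.toNNReal_pos.2 hs.1).ne' (fun w => g ‖w‖)
      (hg.comp measurable_norm)
    rwa [Real.coe_toNNReal _ hs.1.le] at h
  have hρw : ∀ w : Space, Measurable fun s : ℝ => ρ s ‖w‖ := fun w =>
    hρ.comp (measurable_id.prodMk measurable_const)
  rw [setLIntegral_congr_fun measurableSet_Ioc h1, lintegral_lintegral_swap]
  · refine lintegral_congr fun w => ?_
    rw [lintegral_mul_const _ (hρw w), mul_comm]
  · exact ((hρ.comp (measurable_fst.prodMk measurable_snd.norm)).mul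
      (hg.comp measurable_snd.norm)).aemeasurable

/-- Lebesgue-almost every point of `ℝ³` is nonzero. [folklore] -/
theorem ae_ne_zero_space : ∀ᵐ w : Space, w ≠ 0 := by
  have h : (volume : Measure Space) {0} = 0 := measure_singleton 0
  exact measure_eq_zero_iff_ae_notMem.1 h

/-! ### The square of a time integral -/

/-- **`(∫_{(a,b]} φ)² ≤ 2 ∫_{(a,b]} φ(s) (∫_{(s,b]} φ) ds`** for measurable `φ ≥ 0` (split
`∫∫ φ(s)φ(t)` into `t ≤ s` and `s < t`, swap the first part; the diagonal is null). [folklore] -/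
theorem sq_setLIntegral_Ioc_le {φ : ℝ → ℝ≥0∞} (hφ : Measurable φ) (a b : ℝ) :
    (∫⁻ t in Ioc a b, φ t) ^ 2 ≤ 2 * ∫⁻ s in Ioc a b, φ s * ∫⁻ t in Ioc s b, φ t := by
  -- the square as a double integral, split along the diagonal
  have hmeasU : Measurable fun p : ℝ × ℝ => (Iic p.1).indicator (fun t => φ p.1 * φ t) p.2 := by
    have heq : (fun p : ℝ × ℝ => (Iic p.1).indicator (fun t => φ p.1 * φ t) p.2) =
        {p : ℝ × ℝ | p.2 ≤ p.1}.indicator fun p => φ p.1 * φ p.2 := by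
      funext p
      simp only [Set.indicator_apply, Set.mem_Iic, Set.mem_setOf_eq]
    rw [heq]
    exact ((hφ.comp measurable_fst).mul (hφ.comp measurable_snd)).indicator
      (measurableSet_le measurable_snd measurable_fst)
  have hmeasA : ∀ s, Measurable fun t => (Iic s).indicator (fun t => φ s * φ t) t := fun s =>
    (hφ.const_mul _).indicator measurableSet_Iic
  have hsq : (∫⁻ t in Ioc a b, φ t) ^ 2 = ∫⁻ s in Ioc a b, ∫⁻ t in Ioc a b, φ s * φ t := by
    rw [sq, ← lintegral_mul_const _ hφ]
    refine lintegral_congr fun s => ?_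
    rw [lintegral_const_mul _ hφ]
  have hsplit : ∀ s, ∫⁻ t in Ioc a b, φ s * φ t =
      (∫⁻ t in Ioc a b, (Iic s).indicator (fun t => φ s * φ t) t) +
        ∫⁻ t in Ioc a b, (Ioi s).indicator (fun t => φ s * φ t) t := by
    intro s
    rw [← lintegral_add_left (hmeasA s)]
    refine lintegral_congr fun t => ?_
    have h := congr_fun (Set.indicator_self_add_compl (Iic s) (fun t => φ s * φ t)) t
    rw [Set.compl_Iic] at h
    exact h.symm
  rw [hsq]
  simp_rw [hsplit]
  rw [lintegral_add_left ((hmeasU.lintegral_prod_right' (ν := volume.restrict (Ioc a b))))]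
  -- the part `s < t`
  have hB : ∫⁻ s in Ioc a b, ∫⁻ t in Ioc a b, (Ioi s).indicator (fun t => φ s * φ t) t ≤
      ∫⁻ s in Ioc a b, φ s * ∫⁻ t in Ioc s b, φ t := by
    refine lintegral_mono fun s => ?_
    rw [lintegral_indicator measurableSet_Ioi, Measure.restrict_restrict measurableSet_Ioi,
      lintegral_const_mul _ hφ]
    have hsub : Ioi s ∩ Ioc a b ⊆ Ioc s b := fun t ht => ⟨ht.1, ht.2.2⟩
    exact mul_le_mul_right (lintegral_mono_set hsub) _
  -- the part `t ≤ s`, after swapping the integrals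
  have hA : ∫⁻ s in Ioc a b, ∫⁻ t in Ioc a b, (Iic s).indicator (fun t => φ s * φ t) t ≤
      ∫⁻ t in Ioc a b, φ t * ∫⁻ s in Ioc t b, φ s := by
    rw [lintegral_lintegral_swap hmeasU.aemeasurable]
    refine lintegral_mono fun t => ?_
    have h : ∀ s, (Iic s).indicator (fun t => φ s * φ t) t =
        (Ici t).indicator (fun s => φ t * φ s) s := by
      intro s
      simp only [Set.indicator_apply, Set.mem_Iic, Set.mem_Ici]
      split_ifs <;> ring
    simp_rw [h]
    rw [lintegral_indicator measurableSet_Ici, Measure.restrict_restrict measurableSet_Ici,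
      lintegral_const_mul _ hφ]
    refine mul_le_mul_right ?_ _
    have hsub : Ici t ∩ Ioc a b ⊆ Icc t b := fun s hs => ⟨hs.1, hs.2.2⟩
    calc ∫⁻ s in Ici t ∩ Ioc a b, φ s ≤ ∫⁻ s in Icc t b, φ s := lintegral_mono_set hsub
      _ = ∫⁻ s in Ioc t b, φ s := setLIntegral_congr Ioc_ae_eq_Icc.symm
  calc _ ≤ (∫⁻ t in Ioc a b, φ t * ∫⁻ s in Ioc t b, φ s) +
        ∫⁻ s in Ioc a b, φ s * ∫⁻ t in Ioc s b, φ t := add_le_add hA hB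
    _ = 2 * ∫⁻ s in Ioc a b, φ s * ∫⁻ t in Ioc s b, φ t := by rw [two_mul]

/-! ### Transfer of almost-everywhere statements and translations -/

/-- A Lebesgue-a.e. property of `ℝ³` holds a.s. along `Z_t`, `t > 0` (density). [folklore] -/
theorem ae_comp_of_law (hZ : Measurable fun p : Ω × ℝ≥0 => Z p.2 p.1)
    (hlaw : ∀ t : ℝ≥0, t ≠ 0 → ∀ F : Space → ℝ≥0∞, Measurable F →
      ∫⁻ ω, F (Z t ω) ∂P = ∫⁻ w, ρ t ‖w‖ * F w) {t : ℝ≥0} (ht : t ≠ 0) {p : Space → Prop}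
    (hp : ∀ᵐ z : Space, p z) : ∀ᵐ ω ∂P, p (Z t ω) := by
  rw [ae_iff] at hp
  obtain ⟨S, hsub, hSm, hS0⟩ := exists_measurable_superset_of_null hp
  have h := hlaw t ht (S.indicator 1) (measurable_one.indicator hSm)
  have h2 : ∫⁻ ω, S.indicator 1 (Z t ω) ∂P = P (Z t ⁻¹' S) := by
    rw [← lintegral_indicator_one (measurable_proc_at hZ t hSm)]
    rfl
  have h3 : ∫⁻ w : Space, ρ t ‖w‖ * S.indicator 1 w = 0 := by
    have heq : (fun w : Space => ρ t ‖w‖ * S.indicator 1 w) = S.indicator fun w => ρ t ‖w‖ := by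
      funext w
      by_cases hw : w ∈ S <;> simp [hw]
    rw [heq, lintegral_indicator hSm, setLIntegral_measure_zero S _ hS0]
  have hPS : P (Z t ⁻¹' S) = 0 := by rw [← h2, h, h3]
  rw [ae_iff]
  exact measure_mono_null (fun ω hω => hsub hω) hPS

/-- Translation of a time integral: `∫_{(s,∞)} h(t − s) dt = ∫_{(0,∞)} h(τ) dτ`. [folklore] -/
theorem setLIntegral_Ioi_comp_sub (h : ℝ → ℝ≥0∞) (s : ℝ) :
    ∫⁻ t in Ioi s, h (t - s) = ∫⁻ τ in Ioi 0, h τ := by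
  calc ∫⁻ t in Ioi s, h (t - s) = ∫⁻ t, (Ioi s).indicator (fun t => h (t - s)) t :=
        (lintegral_indicator measurableSet_Ioi _).symm
    _ = ∫⁻ t, (Ioi (0 : ℝ)).indicator h (t - s) := by
        refine lintegral_congr fun t => ?_
        by_cases ht : s < t
        · rw [Set.indicator_of_mem (show t ∈ Ioi s from ht),
            Set.indicator_of_mem (show t - s ∈ Ioi (0 : ℝ) from sub_pos.2 ht)]
        · rw [Set.indicator_of_notMem (show t ∉ Ioi s from ht),
            Set.indicator_of_notMem (show t - s ∉ Ioi (0 : ℝ) from fun h' => ht (sub_pos.1 h'))]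
    _ = ∫⁻ t, (Ioi (0 : ℝ)).indicator h t :=
        lintegral_sub_right_eq_self (fun t => (Ioi (0 : ℝ)).indicator h t) s
    _ = ∫⁻ τ in Ioi 0, h τ := lintegral_indicator measurableSet_Ioi _

/-! ### The potential bound along the process -/

/-- **The time-integrated transition potential is bounded**: if `∫_{(0,∞)} ρ_τ(|w|) dτ ≤ C/|w|`
(`w ≠ 0`) and `∫ g(|w|)/|w − z| dw ≤ K m` for a.e. `z`, then for every `s` and a.e. `z`,
`∫_{(s,T]} E[g(|z + Z_{t−s}|)] dt ≤ C K m` (law of `Z_{t−s}`, Tonelli, `(s, T] ⊆ (s, ∞)`,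
translation invariance of Lebesgue measure). [folklore] -/
theorem potential_ae_le (hg : Measurable g) (hρ : Measurable fun p : ℝ × ℝ => ρ p.1 p.2)
    (hlaw : ∀ t : ℝ≥0, t ≠ 0 → ∀ F : Space → ℝ≥0∞, Measurable F →
      ∫⁻ ω, F (Z t ω) ∂P = ∫⁻ w, ρ t ‖w‖ * F w) {C : ℝ} (hC0 : 0 ≤ C)
    (hup : ∀ w : Space, w ≠ 0 → ∫⁻ s in Ioi (0 : ℝ), ρ s ‖w‖ ≤ ENNReal.ofReal (C * ‖w‖⁻¹))
    {K : ℝ} {m : ℝ≥0∞}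
    (hpot : ∀ᵐ x : Space, ∫⁻ w : Space, g ‖w‖ * ENNReal.ofReal (‖w - x‖⁻¹) ≤ ENNReal.ofReal K * m)
    (s T : ℝ) :
    ∀ᵐ z : Space, (∫⁻ t in Ioc s T, ∫⁻ ω', g ‖z + Z (t - s).toNNReal ω'‖ ∂P) ≤
      ENNReal.ofReal C * (ENNReal.ofReal K * m) := by
  filter_upwards [hpot] with z hz
  have h1 : ∀ t ∈ Ioc s T, ∫⁻ ω', g ‖z + Z (t - s).toNNReal ω'‖ ∂P =
      ∫⁻ w : Space, ρ (t - s) ‖w‖ * g ‖z + w‖ := by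
    intro t ht
    have hts : 0 < t - s := sub_pos.2 ht.1
    have h := hlaw (t - s).toNNReal (Real.toNNReal_pos.2 hts).ne' (fun w => g ‖z + w‖)
      (hg.comp (measurable_norm.comp (measurable_const.add measurable_id)))
    rwa [Real.coe_toNNReal _ hts.le] at h
  rw [setLIntegral_congr_fun measurableSet_Ioc h1, lintegral_lintegral_swap]
  swap
  · exact ((hρ.comp ((measurable_fst.sub measurable_const).prodMk measurable_snd.norm)).mul
      (hg.comp (measurable_snd.const_add z).norm)).aemeasurable
  calc ∫⁻ w : Space, ∫⁻ t in Ioc s T, ρ (t - s) ‖w‖ * g ‖z + w‖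
      = ∫⁻ w : Space, (∫⁻ t in Ioc s T, ρ (t - s) ‖w‖) * g ‖z + w‖ :=
        lintegral_congr fun w => lintegral_mul_const _
          (hρ.comp ((measurable_id.sub measurable_const).prodMk measurable_const))
    _ ≤ ∫⁻ w : Space, (∫⁻ τ in Ioi 0, ρ τ ‖w‖) * g ‖z + w‖ := by
        refine lintegral_mono fun w => mul_le_mul_left ?_ _
        calc ∫⁻ t in Ioc s T, ρ (t - s) ‖w‖ ≤ ∫⁻ t in Ioi s, ρ (t - s) ‖w‖ :=
              lintegral_mono_set Ioc_subset_Ioi_self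
          _ = ∫⁻ τ in Ioi 0, ρ τ ‖w‖ := setLIntegral_Ioi_comp_sub (fun τ => ρ τ ‖w‖) s
    _ ≤ ∫⁻ w : Space, ENNReal.ofReal (C * ‖w‖⁻¹) * g ‖z + w‖ := by
        refine lintegral_mono_ae ?_
        filter_upwards [ae_ne_zero_space] with w hw
        exact mul_le_mul_left (hup w hw) _
    _ = ∫⁻ w : Space, ENNReal.ofReal (C * ‖w - z‖⁻¹) * g ‖w‖ := by
        rw [← lintegral_sub_right_eq_self
          (fun w : Space => ENNReal.ofReal (C * ‖w‖⁻¹) * g ‖z + w‖) z]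
        refine lintegral_congr fun w => ?_
        rw [add_sub_cancel]
    _ = ENNReal.ofReal C * ∫⁻ w : Space, g ‖w‖ * ENNReal.ofReal (‖w - z‖⁻¹) := by
        rw [← lintegral_const_mul' _ _ ENNReal.ofReal_ne_top]
        refine lintegral_congr fun w => ?_
        rw [ENNReal.ofReal_mul hC0]
        ring
    _ ≤ ENNReal.ofReal C * (ENNReal.ofReal K * m) := mul_le_mul_right hz _

/-! ### Second moment -/

/-- **Second moment, one time slice**: for `s > 0`,
`E[g(|Z_s|) ∫_{(s,T]} g(|Z_t|) dt] ≤ C K m · E[g(|Z_s|)]` (Tonelli, the Markov factorisation at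
each `t > s`, Tonelli back, and the potential bound along `Z_s`, whose law has a density).
[folklore] -/
theorem lintegral_slice_le [SFinite P] (hZ : Measurable fun p : Ω × ℝ≥0 => Z p.2 p.1)
    (hg : Measurable g) (hρ : Measurable fun p : ℝ × ℝ => ρ p.1 p.2)
    (hlaw : ∀ t : ℝ≥0, t ≠ 0 → ∀ F : Space → ℝ≥0∞, Measurable F →
      ∫⁻ ω, F (Z t ω) ∂P = ∫⁻ w, ρ t ‖w‖ * F w)
    (hmarkov : ∀ (s τ : ℝ≥0) (F H : Space → ℝ≥0∞), Measurable F → Measurable H →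
      ∫⁻ ω, F (Z s ω) * H (Z (s + τ) ω) ∂P = ∫⁻ ω, F (Z s ω) * ∫⁻ ω', H (Z s ω + Z τ ω') ∂P ∂P)
    {C : ℝ} (hC0 : 0 ≤ C)
    (hup : ∀ w : Space, w ≠ 0 → ∫⁻ s in Ioi (0 : ℝ), ρ s ‖w‖ ≤ ENNReal.ofReal (C * ‖w‖⁻¹))
    {K : ℝ} {m : ℝ≥0∞}
    (hpot : ∀ᵐ x : Space, ∫⁻ w : Space, g ‖w‖ * ENNReal.ofReal (‖w - x‖⁻¹) ≤ ENNReal.ofReal K * m)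
    {s : ℝ} (hs : 0 < s) (T : ℝ) :
    ∫⁻ ω, g ‖Z s.toNNReal ω‖ * (∫⁻ t in Ioc s T, g ‖Z t.toNNReal ω‖) ∂P ≤
      ENNReal.ofReal C * (ENNReal.ofReal K * m) * ∫⁻ ω, g ‖Z s.toNNReal ω‖ ∂P := by
  have hgn : Measurable fun z : Space => g ‖z‖ := hg.comp measurable_norm
  have hft : ∀ ω, Measurable fun t : ℝ => g ‖Z t.toNNReal ω‖ := fun ω =>
    hg.comp ((measurable_proc_real hZ).comp (measurable_const.prodMk measurable_id)).norm
  have hfs : Measurable fun ω => g ‖Z s.toNNReal ω‖ := hgn.comp (measurable_proc_at hZ _)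
  -- the inner expectation `(t, ω) ↦ E'[g |Z_s ω + Z'_{t-s}|]` is jointly measurable
  have hinner3 : Measurable fun q : (ℝ × Ω) × Ω =>
      g ‖Z s.toNNReal q.1.2 + Z (q.1.1 - s).toNNReal q.2‖ := by
    refine hgn.comp (Measurable.add ?_ ?_)
    · exact (measurable_proc_at hZ _).comp (measurable_snd.comp measurable_fst)
    · exact (measurable_proc_real hZ).comp
        (measurable_snd.prodMk ((measurable_fst.comp measurable_fst).sub measurable_const))
  have hinner : Measurable fun q : ℝ × Ω =>
      ∫⁻ ω', g ‖Z s.toNNReal q.2 + Z (q.1 - s).toNNReal ω'‖ ∂P :=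
    hinner3.lintegral_prod_right'
  have hGm : ∀ ω, Measurable fun t : ℝ =>
      ∫⁻ ω', g ‖Z s.toNNReal ω + Z (t - s).toNNReal ω'‖ ∂P := by
    intro ω
    have h3 : Measurable fun q : ℝ × Ω => g ‖Z s.toNNReal ω + Z (q.1 - s).toNNReal q.2‖ :=
      hgn.comp (measurable_const.add ((measurable_proc_real hZ).comp
        (measurable_snd.prodMk (measurable_fst.sub measurable_const))))
    exact h3.lintegral_prod_right'
  -- the Markov factorisation at each `t ∈ (s, T]`
  have hM : ∀ t ∈ Ioc s T, ∫⁻ ω, g ‖Z s.toNNReal ω‖ * g ‖Z t.toNNReal ω‖ ∂P =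
      ∫⁻ ω, g ‖Z s.toNNReal ω‖ *
        ∫⁻ ω', g ‖Z s.toNNReal ω + Z (t - s).toNNReal ω'‖ ∂P ∂P := by
    intro t ht
    have hdec : t.toNNReal = s.toNNReal + (t - s).toNNReal := by
      rw [← Real.toNNReal_add hs.le (sub_pos.2 ht.1).le]
      congr 1
      ring
    rw [hdec]
    exact hmarkov s.toNNReal (t - s).toNNReal (fun z => g ‖z‖) (fun z => g ‖z‖) hgn hgn
  -- the potential bound along `Z_s`
  have hΦ : ∀ᵐ ω ∂P, (∫⁻ t in Ioc s T, ∫⁻ ω', g ‖Z s.toNNReal ω + Z (t - s).toNNReal ω'‖ ∂P) ≤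
      ENNReal.ofReal C * (ENNReal.ofReal K * m) :=
    ae_comp_of_law hZ hlaw (t := s.toNNReal) (Real.toNNReal_pos.2 hs).ne'
      (potential_ae_le hg hρ hlaw hC0 hup hpot s T)
  -- Tonelli, Markov, Tonelli back, and the bound
  calc ∫⁻ ω, g ‖Z s.toNNReal ω‖ * (∫⁻ t in Ioc s T, g ‖Z t.toNNReal ω‖) ∂P
      = ∫⁻ ω, (∫⁻ t in Ioc s T, g ‖Z s.toNNReal ω‖ * g ‖Z t.toNNReal ω‖) ∂P :=
        lintegral_congr fun ω => (lintegral_const_mul _ (hft ω)).symm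
    _ = ∫⁻ t in Ioc s T, ∫⁻ ω, g ‖Z s.toNNReal ω‖ * g ‖Z t.toNNReal ω‖ ∂P :=
        lintegral_lintegral_swap
          ((hfs.comp measurable_fst).mul (measurable_occupationIntegrand hZ hg)).aemeasurable
    _ = ∫⁻ t in Ioc s T, ∫⁻ ω, g ‖Z s.toNNReal ω‖ *
          ∫⁻ ω', g ‖Z s.toNNReal ω + Z (t - s).toNNReal ω'‖ ∂P ∂P :=
        setLIntegral_congr_fun measurableSet_Ioc hM
    _ = ∫⁻ ω, (∫⁻ t in Ioc s T, g ‖Z s.toNNReal ω‖ *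
          ∫⁻ ω', g ‖Z s.toNNReal ω + Z (t - s).toNNReal ω'‖ ∂P) ∂P :=
        lintegral_lintegral_swap ((hfs.comp measurable_snd).mul hinner).aemeasurable
    _ = ∫⁻ ω, g ‖Z s.toNNReal ω‖ * (∫⁻ t in Ioc s T,
          ∫⁻ ω', g ‖Z s.toNNReal ω + Z (t - s).toNNReal ω'‖ ∂P) ∂P :=
        lintegral_congr fun ω => lintegral_const_mul _ (hGm ω)
    _ ≤ ∫⁻ ω, g ‖Z s.toNNReal ω‖ * (ENNReal.ofReal C * (ENNReal.ofReal K * m)) ∂P := by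
        refine lintegral_mono_ae ?_
        filter_upwards [hΦ] with ω hω
        exact mul_le_mul_right hω _
    _ = ENNReal.ofReal C * (ENNReal.ofReal K * m) * ∫⁻ ω, g ‖Z s.toNNReal ω‖ ∂P := by
        rw [lintegral_mul_const _ hfs, mul_comm]

/-- **Second moment of the occupation functional**: `E[J²] ≤ 2 C K m · E J`. [folklore] -/
theorem lintegral_occupation_sq_le {Ω : Type*} [MeasurableSpace Ω] {P : Measure Ω} [SFinite P]
    {Z : ℝ≥0 → Ω → Space} {ρ : ℝ → ℝ → ℝ≥0∞} {g : ℝ → ℝ≥0∞}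
    (hZ : Measurable fun p : Ω × ℝ≥0 => Z p.2 p.1) (hg : Measurable g)
    (hρ : Measurable fun p : ℝ × ℝ => ρ p.1 p.2)
    (hlaw : ∀ t : ℝ≥0, t ≠ 0 → ∀ F : Space → ℝ≥0∞, Measurable F →
      ∫⁻ ω, F (Z t ω) ∂P = ∫⁻ w, ρ t ‖w‖ * F w)
    (hmarkov : ∀ (s τ : ℝ≥0) (F H : Space → ℝ≥0∞), Measurable F → Measurable H →
      ∫⁻ ω, F (Z s ω) * H (Z (s + τ) ω) ∂P = ∫⁻ ω, F (Z s ω) * ∫⁻ ω', H (Z s ω + Z τ ω') ∂P ∂P)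
    {C : ℝ} (hC0 : 0 ≤ C)
    (hup : ∀ w : Space, w ≠ 0 → ∫⁻ s in Ioi (0 : ℝ), ρ s ‖w‖ ≤ ENNReal.ofReal (C * ‖w‖⁻¹))
    {K : ℝ} {m : ℝ≥0∞} (hmT : m ≠ ⊤)
    (hpot : ∀ᵐ x : Space, ∫⁻ w : Space, g ‖w‖ * ENNReal.ofReal (‖w - x‖⁻¹) ≤ ENNReal.ofReal K * m)
    (T : ℝ) :
    ∫⁻ ω, (∫⁻ s in Ioc 0 T, g ‖Z s.toNNReal ω‖) ^ 2 ∂P ≤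
      2 * (ENNReal.ofReal C * (ENNReal.ofReal K * m)) *
        ∫⁻ ω, (∫⁻ s in Ioc 0 T, g ‖Z s.toNNReal ω‖) ∂P := by
  set B : ℝ≥0∞ := ENNReal.ofReal C * (ENNReal.ofReal K * m) with hB
  have hBtop : B ≠ ⊤ :=
    ENNReal.mul_ne_top ENNReal.ofReal_ne_top (ENNReal.mul_ne_top ENNReal.ofReal_ne_top hmT)
  have hft : ∀ ω, Measurable fun t : ℝ => g ‖Z t.toNNReal ω‖ := fun ω =>
    hg.comp ((measurable_proc_real hZ).comp (measurable_const.prodMk measurable_id)).norm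
  calc ∫⁻ ω, (∫⁻ s in Ioc 0 T, g ‖Z s.toNNReal ω‖) ^ 2 ∂P
      ≤ ∫⁻ ω, 2 * (∫⁻ s in Ioc 0 T, g ‖Z s.toNNReal ω‖ *
          ∫⁻ t in Ioc s T, g ‖Z t.toNNReal ω‖) ∂P :=
        lintegral_mono fun ω => sq_setLIntegral_Ioc_le (hft ω) 0 T
    _ = 2 * ∫⁻ s in Ioc 0 T, ∫⁻ ω, g ‖Z s.toNNReal ω‖ *
          (∫⁻ t in Ioc s T, g ‖Z t.toNNReal ω‖) ∂P := by
        rw [lintegral_const_mul' _ _ ENNReal.ofNat_ne_top, lintegral_lintegral_swap]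
        exact ((measurable_occupationIntegrand hZ hg).mul
          (measurable_tailOccupation hZ hg T)).aemeasurable
    _ ≤ 2 * ∫⁻ s in Ioc 0 T, B * ∫⁻ ω, g ‖Z s.toNNReal ω‖ ∂P := by
        refine mul_le_mul_right (setLIntegral_mono' measurableSet_Ioc fun s hs => ?_) _
        exact lintegral_slice_le hZ hg hρ hlaw hmarkov hC0 hup hpot hs.1 T
    _ = 2 * B * ∫⁻ ω, (∫⁻ s in Ioc 0 T, g ‖Z s.toNNReal ω‖) ∂P := by
        rw [lintegral_const_mul' _ _ hBtop, lintegral_occupation_eq hZ hg T, ← mul_assoc]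

end Summit.AtomisticToContinuum.BoseEinsteinCondensation.Theorems.CutLineWitness

end
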